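import Summits.QuantumFields.YangMills.Theorems.ColdStartUniversalityLatticeLangevinHeatKernelSemigroup
import Literature.Analysis.InverseSpectral.HelicalFunctionProofsLattice
import HarnessLib

/-!
# Route `ColdStartUniversality` (fixed-cut-off package, `β' = 0`): the SU(2) heat kernel is STRICTLY POSITIVE at every time `t > 0`

Helper file (seat `ym-line-csu-p1`, g12, free hands; closes brick 3 of the small-time Doeblin programme).  With
`h_t(U) = Σ (n+1) e^{-n(n+2)t/2} χ_n(U)` (inline), `h_t(1) = Σ (n+1)² e^{-n(n+2)t/2}` and the deficiency majorant
`D_t = Σ (n+1) e^{-n(n+2)t/2} n(n+1)(n+2)/3` of `…HeatKernelLocalBound`: `tsum_exp_neg_mul_sq_le` (`Σ_{m≥1} e^{-a m²} ≤ 2/√a`,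
`0 < a ≤ 1`); `heatKernelSU2_deficiencyMajorant_le` (`D_t ≤ 256/(3t²√t)`) and `heatKernelSU2_one_ge` (`h_t(1) ≥ 1/(48t√t)`) for
`0 < t ≤ 1`, hence ★ `heatKernelSU2_pos_of_lt_mul` (`h_t > 0` on `{1 − Re tr/2 < t/4096}`); `heatKernelSU2_pos_iterate` (the doubling
iteration of `…HeatKernelSemigroup`: threshold `a ↦ 2a(2−a) ≥ 3a` per time doubling while `a ≤ 1/2`, then everywhere);
★★ `heatKernelSU2_pos` — `h_t(U) > 0` for ALL `t > 0`, ALL `U ∈ SU(2)`; ★ `exists_pos_le_heatKernelSU2` (uniform `c_t > 0` by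
compactness) and the product form `exists_pos_le_prod_heatKernelSU2` on `SU(2)^E`.  THEOREMS ONLY, [folklore]; RECORD-rung R3
plumbing (input of Doeblin at small lattice times / the TP rung `FixedCutoffOverlap` for short windows); no crux, rung or summit is
proved here; the Yang–Mills mass gap is NOT proved.
-/

set_option autoImplicit false

noncomputable section

namespace Summit.QuantumFields.YangMills.Theorems.ColdStartUniversality

open MeasureTheory Finset Filter
open scoped BigOperators Topology Matrix
open Literature.MathematicalPhysics.QuantumFieldTheory
open Literature.MathematicalPhysics.QuantumFieldTheory.Tomboulis2007 (su2Char)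
open Literature.Analysis.SpecialFunctions (gegenbauerSum)

/-! ## A Gaussian sum bound -/

/-- `Σ_{m ≥ 0} e^{-a (m+1)²} ≤ 2/√a` for `0 < a ≤ 1`: the first `⌊1/√a⌋` terms are `≤ 1`, the rest is a geometric series with
ratio `e^{-a(⌊1/√a⌋+1)} ≤ e^{-√a}`, of sum `≤ 1/√a`. [folklore] -/
theorem tsum_exp_neg_mul_sq_le {a : ℝ} (ha : 0 < a) (ha1 : a ≤ 1) :
    ∑' m : ℕ, Real.exp (-(a * ((m : ℝ) + 1) ^ 2)) ≤ 2 / Real.sqrt a := by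
  have hsa : 0 < Real.sqrt a := Real.sqrt_pos.2 ha
  have hsa1 : Real.sqrt a ≤ 1 := by rw [← Real.sqrt_one]; exact Real.sqrt_le_sqrt ha1
  have hsq : Real.sqrt a * Real.sqrt a = a := Real.mul_self_sqrt ha.le
  set N : ℕ := ⌊1 / Real.sqrt a⌋₊ with hN
  have hN1 : (N : ℝ) ≤ 1 / Real.sqrt a := Nat.floor_le (by positivity)
  have hN2 : 1 / Real.sqrt a < (N : ℝ) + 1 := Nat.lt_floor_add_one _
  -- the terms and a geometric majorant of the shifted terms
  set f : ℕ → ℝ := fun m => Real.exp (-(a * ((m : ℝ) + 1) ^ 2)) with hf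
  set ρ : ℝ := Real.exp (-(a * ((N : ℝ) + 1))) with hρ
  have hρ0 : 0 < ρ := Real.exp_pos _
  have hρ1 : ρ < 1 := by rw [hρ]; exact Real.exp_lt_one_iff.2 (by nlinarith [N.cast_nonneg (α := ℝ)])
  have hfle : ∀ m : ℕ, f (m + N) ≤ ρ ^ (m + 1) := by
    intro m
    rw [hf, hρ, ← Real.exp_nat_mul, Real.exp_le_exp]
    have hm : (0 : ℝ) ≤ m := m.cast_nonneg
    have hNn : (0 : ℝ) ≤ N := N.cast_nonneg
    have hprod : ((N : ℝ) + 1) * ((m : ℝ) + 1) ≤ (((m + N : ℕ) : ℝ) + 1) ^ 2 := by push_cast; nlinarith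
    have := mul_le_mul_of_nonneg_left hprod ha.le
    push_cast at this ⊢
    nlinarith [this]
  have hf0 : ∀ m, 0 ≤ f m := fun m => (Real.exp_pos _).le
  have hgeo : Summable fun m : ℕ => ρ ^ (m + 1) :=
    (summable_geometric_of_lt_one hρ0.le hρ1).comp_injective (add_left_injective 1)
  have hsum_shift : Summable fun m => f (m + N) := Summable.of_nonneg_of_le (fun m => hf0 _) hfle hgeo
  have hsum : Summable f := (summable_nat_add_iff N).1 hsum_shift
  rw [← hsum.sum_add_tsum_nat_add N]
  -- head: `N` terms `≤ 1`
  have hhead : ∑ i ∈ Finset.range N, f i ≤ (N : ℝ) := by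
    have h : ∀ i ∈ Finset.range N, f i ≤ 1 := fun i _ => by
      rw [hf]; exact Real.exp_le_one_iff.2 (by nlinarith [sq_nonneg ((i : ℝ) + 1)])
    calc ∑ i ∈ Finset.range N, f i ≤ ∑ _i ∈ Finset.range N, (1 : ℝ) := Finset.sum_le_sum h
      _ = N := by simp
  -- tail: geometric
  have htail : ∑' m, f (m + N) ≤ 1 / Real.sqrt a := by
    have h1 : ∑' m, f (m + N) ≤ ∑' m : ℕ, ρ ^ (m + 1) := Summable.tsum_le_tsum hfle hsum_shift hgeo
    have h2 : ∑' m : ℕ, ρ ^ (m + 1) = ρ / (1 - ρ) := by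
      rw [show (fun m : ℕ => ρ ^ (m + 1)) = fun m => ρ * ρ ^ m from funext fun m => by ring, tsum_mul_left,
        tsum_geometric_of_lt_one hρ0.le hρ1]
      ring
    -- `ρ/(1-ρ) = 1/(ρ⁻¹ - 1) ≤ 1/(a(N+1)) ≤ 1/√a`
    have hx : Real.sqrt a ≤ a * ((N : ℝ) + 1) := by
      have := mul_le_mul_of_nonneg_left hN2.le ha.le
      rwa [mul_one_div, Real.div_sqrt] at this
    have hexp : a * ((N : ℝ) + 1) + 1 ≤ ρ⁻¹ := by
      rw [hρ, ← Real.exp_neg, neg_neg]; exact Real.add_one_le_exp _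
    have h3 : ρ / (1 - ρ) ≤ 1 / Real.sqrt a := by
      rw [div_le_div_iff₀ (by linarith) hsa]
      -- `ρ √a ≤ 1 - ρ`, i.e. `ρ (√a + 1) ≤ 1`; from `ρ (a(N+1) + 1) ≤ 1` and `√a ≤ a(N+1)`
      have h4 : ρ * (a * ((N : ℝ) + 1) + 1) ≤ 1 := by
        have := mul_le_mul_of_nonneg_left hexp hρ0.le
        rwa [mul_inv_cancel₀ hρ0.ne'] at this
      nlinarith [mul_le_mul_of_nonneg_left hx hρ0.le]
    exact h1.trans (h2.le.trans h3)
  calc ∑ i ∈ Finset.range N, f i + ∑' m, f (m + N) ≤ 1 / Real.sqrt a + 1 / Real.sqrt a := add_le_add (hhead.trans hN1) htail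
    _ = 2 / Real.sqrt a := by ring

/-! ## Asymptotic bounds at small times -/

/-- `χ_n(1) = n + 1`. [folklore] -/
theorem su2Char_one_apply (n : ℕ) : su2Char n (1 : Matrix.specialUnitaryGroup (Fin 2) ℂ) = (n : ℝ) + 1 := by
  rw [su2Char_eq_gegenbauerSum]
  have h1 : (((1 : Matrix.specialUnitaryGroup (Fin 2) ℂ) : Matrix (Fin 2) (Fin 2) ℂ).trace.re / 2) = 1 := by
    simp [Matrix.trace]
  rw [h1, gegenbauerSum_one_at_one]

/-- **Upper bound of the deficiency majorant at small times**: `D_t ≤ 256/(3 t² √t)` for `0 < t ≤ 1`. [folklore] -/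
theorem heatKernelSU2_deficiencyMajorant_le {t : ℝ} (ht : 0 < t) (ht1 : t ≤ 1) :
    ∑' n : ℕ, ((n : ℝ) + 1) * Real.exp (-((n : ℝ) * ((n : ℝ) + 2) / 2) * t) * ((n : ℝ) * ((n : ℝ) + 1) * ((n : ℝ) + 2) / 3) ≤
      256 / (3 * (t ^ 2 * Real.sqrt t)) := by
  have hst : 0 < Real.sqrt t := Real.sqrt_pos.2 ht
  -- termwise: `(n+1) q_n n(n+1)(n+2)/3 ≤ (64/(3t²)) e^{-(t/4)(n+1)²}`
  have hterm : ∀ n : ℕ, ((n : ℝ) + 1) * Real.exp (-((n : ℝ) * ((n : ℝ) + 2) / 2) * t) *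
      ((n : ℝ) * ((n : ℝ) + 1) * ((n : ℝ) + 2) / 3) ≤ 64 / (3 * t ^ 2) * Real.exp (-(t / 4 * ((n : ℝ) + 1) ^ 2)) := by
    intro n
    have hn : (0 : ℝ) ≤ n := n.cast_nonneg
    set m : ℝ := (n : ℝ) + 1 with hm
    have hm1 : 1 ≤ m := by rw [hm]; linarith
    -- polynomial part `≤ m⁴/3`
    have hpoly : ((n : ℝ) + 1) * ((n : ℝ) * ((n : ℝ) + 1) * ((n : ℝ) + 2) / 3) ≤ m ^ 4 / 3 := by
      rw [hm]; nlinarith [mul_nonneg hn hn, mul_nonneg (mul_nonneg hn hn) hn]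
    -- exponential part: `e^{-n(n+2)t/2} = e^{t/2} e^{-m²t/2} ≤ 2 e^{-m² t/4} e^{-m² t/4}`
    have hexp : Real.exp (-((n : ℝ) * ((n : ℝ) + 2) / 2) * t) =
        Real.exp (t / 2) * (Real.exp (-(m ^ 2 * t / 4)) * Real.exp (-(t / 4 * m ^ 2))) := by
      rw [← Real.exp_add, ← Real.exp_add]; congr 1; rw [hm]; ring
    have he2 : Real.exp (t / 2) ≤ 2 := by
      have h1 : Real.exp (t / 2) ≤ Real.exp (1 / 2 : ℝ) := Real.exp_le_exp.2 (by linarith)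
      have h2 : Real.exp (1 / 2 : ℝ) ≤ 2 := by
        have h3 : Real.exp (1 / 2 : ℝ) ^ 2 = Real.exp 1 := by rw [← Real.exp_nat_mul]; norm_num
        nlinarith [Real.exp_one_lt_d9, Real.exp_pos (1 / 2 : ℝ)]
      exact h1.trans h2
    -- `m⁴ e^{-m² t/4} ≤ 32/t²`
    have hm4 : m ^ 4 * Real.exp (-(m ^ 2 * t / 4)) ≤ 32 / t ^ 2 := by
      have hu : 0 ≤ m ^ 2 * t / 4 := by positivity
      -- `u² e^{-u} ≤ 2` for `u ≥ 0`
      have h : (m ^ 2 * t / 4) ^ 2 * Real.exp (-(m ^ 2 * t / 4)) ≤ 2 := by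
        have hq := Real.quadratic_le_exp_of_nonneg hu
        rw [Real.exp_neg, mul_inv_le_iff₀ (Real.exp_pos _)]
        nlinarith
      have heq : m ^ 4 * Real.exp (-(m ^ 2 * t / 4)) = (16 / t ^ 2) * ((m ^ 2 * t / 4) ^ 2 * Real.exp (-(m ^ 2 * t / 4))) := by
        field_simp
        ring
      rw [heq]
      calc 16 / t ^ 2 * ((m ^ 2 * t / 4) ^ 2 * Real.exp (-(m ^ 2 * t / 4))) ≤ 16 / t ^ 2 * 2 :=
            mul_le_mul_of_nonneg_left h (by positivity)
        _ = 32 / t ^ 2 := by ring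
    have hA : 0 ≤ Real.exp (-(t / 4 * m ^ 2)) := (Real.exp_pos _).le
    calc ((n : ℝ) + 1) * Real.exp (-((n : ℝ) * ((n : ℝ) + 2) / 2) * t) * ((n : ℝ) * ((n : ℝ) + 1) * ((n : ℝ) + 2) / 3)
        = (((n : ℝ) + 1) * ((n : ℝ) * ((n : ℝ) + 1) * ((n : ℝ) + 2) / 3)) * Real.exp (-((n : ℝ) * ((n : ℝ) + 2) / 2) * t) := by
          ring
      _ ≤ (m ^ 4 / 3) * Real.exp (-((n : ℝ) * ((n : ℝ) + 2) / 2) * t) :=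
          mul_le_mul_of_nonneg_right hpoly (Real.exp_pos _).le
      _ = (1 / 3) * Real.exp (t / 2) * (m ^ 4 * Real.exp (-(m ^ 2 * t / 4))) * Real.exp (-(t / 4 * m ^ 2)) := by
          rw [hexp]; ring
      _ ≤ (1 / 3) * 2 * (32 / t ^ 2) * Real.exp (-(t / 4 * m ^ 2)) := by
          refine mul_le_mul_of_nonneg_right ?_ hA
          exact mul_le_mul (mul_le_mul_of_nonneg_left he2 (by norm_num)) hm4 (by positivity) (by positivity)
      _ = 64 / (3 * t ^ 2) * Real.exp (-(t / 4 * ((n : ℝ) + 1) ^ 2)) := by rw [hm]; ring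
  have hgauss := tsum_exp_neg_mul_sq_le (a := t / 4) (by positivity) (by linarith)
  have hsumg : Summable fun n : ℕ => Real.exp (-(t / 4 * ((n : ℝ) + 1) ^ 2)) := by
    -- comparison with the geometric series `e^{-(t/4)(n+1)}`
    have hρ1 : Real.exp (-(t / 4)) < 1 := Real.exp_lt_one_iff.2 (by linarith)
    refine Summable.of_nonneg_of_le (fun n => (Real.exp_pos _).le) (fun n => ?_)
      ((summable_geometric_of_lt_one (Real.exp_pos _).le hρ1).comp_injective (add_left_injective 1))
    simp only [Function.comp]
    rw [← Real.exp_nat_mul, Real.exp_le_exp]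
    have hn : (0 : ℝ) ≤ n := n.cast_nonneg
    have h1 : (n : ℝ) + 1 ≤ ((n : ℝ) + 1) ^ 2 := by nlinarith
    push_cast
    nlinarith [mul_le_mul_of_nonneg_left h1 (by positivity : (0 : ℝ) ≤ t / 4)]
  have hle := Summable.tsum_le_tsum hterm (summable_heatKernelSU2_deficiencyMajorant ht) (hsumg.mul_left _)
  refine hle.trans ?_
  rw [tsum_mul_left]
  have hsq4 : Real.sqrt (t / 4) = Real.sqrt t / 2 := by
    rw [Real.sqrt_div' t (by norm_num : (0 : ℝ) ≤ 4), show (4 : ℝ) = 2 ^ 2 by norm_num, Real.sqrt_sq (by norm_num : (0 : ℝ) ≤ 2)]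
  rw [hsq4] at hgauss
  calc 64 / (3 * t ^ 2) * ∑' n : ℕ, Real.exp (-(t / 4 * ((n : ℝ) + 1) ^ 2)) ≤ 64 / (3 * t ^ 2) * (2 / (Real.sqrt t / 2)) :=
        mul_le_mul_of_nonneg_left hgauss (by positivity)
    _ = 256 / (3 * (t ^ 2 * Real.sqrt t)) := by field_simp; ring

/-- **Lower bound of `h_t(1)` at small times**: `h_t(1) ≥ 1/(48 t √t)` for `0 < t ≤ 1`. [folklore] -/
theorem heatKernelSU2_one_ge {t : ℝ} (ht : 0 < t) (ht1 : t ≤ 1) :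
    1 / (48 * (t * Real.sqrt t)) ≤ ∑' n : ℕ, ((n : ℝ) + 1) * Real.exp (-((n : ℝ) * ((n : ℝ) + 2) / 2) * t) *
      su2Char n (1 : Matrix.specialUnitaryGroup (Fin 2) ℂ) := by
  have hst : 0 < Real.sqrt t := Real.sqrt_pos.2 ht
  have hsq : Real.sqrt t * Real.sqrt t = t := Real.mul_self_sqrt ht.le
  have hst1 : Real.sqrt t ≤ 1 := by rw [← Real.sqrt_one]; exact Real.sqrt_le_sqrt ht1
  simp_rw [su2Char_one_apply]
  set N : ℕ := ⌊1 / Real.sqrt t⌋₊ with hN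
  have hy1 : 1 ≤ 1 / Real.sqrt t := by rw [le_div_iff₀ hst]; linarith
  have hN1 : (N : ℝ) ≤ 1 / Real.sqrt t := Nat.floor_le (by positivity)
  have hN2 : 1 / Real.sqrt t < (N : ℝ) + 1 := Nat.lt_floor_add_one _
  have hNge1 : 1 ≤ N := Nat.one_le_floor_iff _ |>.2 hy1
  -- `N ≥ (1/√t)/2`
  have hNhalf : 1 / Real.sqrt t / 2 ≤ (N : ℝ) := by
    have h1 : (1 : ℝ) ≤ N := by exact_mod_cast hNge1
    by_cases hy2 : 1 / Real.sqrt t < 2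
    · linarith
    · rw [not_lt] at hy2; linarith
  have hsum := summable_heatKernelSU2 ht (1 : Matrix.specialUnitaryGroup (Fin 2) ℂ)
  simp_rw [su2Char_one_apply] at hsum
  -- the terms are non-negative; keep the first `N`
  have hnn : ∀ n : ℕ, 0 ≤ ((n : ℝ) + 1) * Real.exp (-((n : ℝ) * ((n : ℝ) + 2) / 2) * t) * ((n : ℝ) + 1) := fun n => by positivity
  have hpart := hsum.sum_le_tsum (Finset.range N) (fun n _ => hnn n)
  refine le_trans ?_ hpart
  -- on `n < N`: `n(n+2) t/2 ≤ 1/2`, so the exponential is `≥ 1/2`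
  have hlow : ∀ n ∈ Finset.range N, (1 / 2 : ℝ) * ((n : ℝ) + 1) ^ 2 ≤
      ((n : ℝ) + 1) * Real.exp (-((n : ℝ) * ((n : ℝ) + 2) / 2) * t) * ((n : ℝ) + 1) := by
    intro n hn
    have hnN : n + 1 ≤ N := Finset.mem_range.1 hn
    have hnN' : (n : ℝ) + 1 ≤ N := by exact_mod_cast hnN
    have hn0 : (0 : ℝ) ≤ n := n.cast_nonneg
    -- `N √t ≤ 1` hence `N² t ≤ 1` and `n(n+2) ≤ N² - 1`
    have hNt : (N : ℝ) * Real.sqrt t ≤ 1 := by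
      have := mul_le_mul_of_nonneg_right hN1 hst.le
      rwa [one_div, inv_mul_cancel₀ hst.ne'] at this
    have hN2t : (N : ℝ) ^ 2 * t ≤ 1 := by
      have h0 : 0 ≤ (N : ℝ) * Real.sqrt t := by positivity
      nlinarith [hsq, hNt, h0]
    have hexp_arg : -((n : ℝ) * ((n : ℝ) + 2) / 2) * t ≥ -(1 / 2 : ℝ) := by
      have : (n : ℝ) * ((n : ℝ) + 2) ≤ (N : ℝ) ^ 2 := by nlinarith
      nlinarith [ht]
    have hexp : (1 / 2 : ℝ) ≤ Real.exp (-((n : ℝ) * ((n : ℝ) + 2) / 2) * t) := by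
      have h1 : Real.exp (-(1 / 2 : ℝ)) ≤ Real.exp (-((n : ℝ) * ((n : ℝ) + 2) / 2) * t) := Real.exp_le_exp.2 hexp_arg
      refine le_trans ?_ h1
      rw [Real.exp_neg, le_inv_comm₀ (by norm_num) (Real.exp_pos _)]
      have h3 : Real.exp (1 / 2 : ℝ) ^ 2 = Real.exp 1 := by rw [← Real.exp_nat_mul]; norm_num
      nlinarith [Real.exp_one_lt_d9, Real.exp_pos (1 / 2 : ℝ)]
    calc (1 / 2 : ℝ) * ((n : ℝ) + 1) ^ 2 = ((n : ℝ) + 1) * (1 / 2) * ((n : ℝ) + 1) := by ring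
      _ ≤ ((n : ℝ) + 1) * Real.exp (-((n : ℝ) * ((n : ℝ) + 2) / 2) * t) * ((n : ℝ) + 1) := by
          refine mul_le_mul_of_nonneg_right (mul_le_mul_of_nonneg_left hexp (by positivity)) (by positivity)
  have hS := Finset.sum_le_sum hlow
  refine le_trans ?_ hS
  rw [← Finset.mul_sum]
  have hcube := Literature.Analysis.InverseSpectral.cube_div_three_le_sum_sq N
  -- `1/(48 t√t) ≤ (1/2) N³/3` from `N ≥ 1/(2√t)`
  have hN3 : 1 / (t * Real.sqrt t) / 8 ≤ (N : ℝ) ^ 3 := by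
    have h0 : 0 ≤ 1 / Real.sqrt t / 2 := by positivity
    have h1 := pow_le_pow_left₀ h0 hNhalf 3
    refine le_trans (le_of_eq ?_) h1
    rw [div_pow, div_pow, one_pow, pow_succ (Real.sqrt t) 2, Real.sq_sqrt ht.le]
    norm_num
  calc 1 / (48 * (t * Real.sqrt t)) = (1 / 2) * ((1 / (t * Real.sqrt t) / 8) / 3) := by field_simp; ring
    _ ≤ (1 / 2) * ((N : ℝ) ^ 3 / 3) := by gcongr
    _ ≤ (1 / 2) * ∑ n ∈ Finset.range N, ((n : ℝ) + 1) ^ 2 := mul_le_mul_of_nonneg_left hcube (by norm_num)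

/-- ★ **Local positivity with an explicit radius**: for `0 < t ≤ 1`, `h_t(U) > 0` whenever `1 − Re tr U/2 < t/4096`
(`h_t(1)/D_t ≥ (1/(48 t√t)) / (256/(3 t²√t)) = t/4096`). [folklore] -/
theorem heatKernelSU2_pos_of_lt_mul {t : ℝ} (ht : 0 < t) (ht1 : t ≤ 1) (U : Matrix.specialUnitaryGroup (Fin 2) ℂ)
    (hU : 1 - ((U : Matrix (Fin 2) (Fin 2) ℂ)).trace.re / 2 < t / 4096) :
    0 < ∑' n : ℕ, ((n : ℝ) + 1) * Real.exp (-((n : ℝ) * ((n : ℝ) + 2) / 2) * t) * su2Char n U := by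
  have hst : 0 < Real.sqrt t := Real.sqrt_pos.2 ht
  have hD := heatKernelSU2_deficiencyMajorant_le ht ht1
  have h1 := heatKernelSU2_one_ge ht ht1
  have hx := (re_trace_div_two_mem U).2
  have hx0 : 0 ≤ 1 - ((U : Matrix (Fin 2) (Fin 2) ℂ)).trace.re / 2 := by linarith
  refine heatKernelSU2_pos_near_one ht U (lt_of_le_of_lt (mul_le_mul_of_nonneg_left hD hx0) ?_)
  refine lt_of_lt_of_le ?_ h1
  -- `(1 - x) · 256/(3 t²√t) < 1/(48 t√t)` from `1 - x < t/4096`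
  have hpos : 0 < 256 / (3 * (t ^ 2 * Real.sqrt t)) := by positivity
  calc (1 - ((U : Matrix (Fin 2) (Fin 2) ℂ)).trace.re / 2) * (256 / (3 * (t ^ 2 * Real.sqrt t)))
      < t / 4096 * (256 / (3 * (t ^ 2 * Real.sqrt t))) := mul_lt_mul_of_pos_right hU hpos
    _ = 1 / (48 * (t * Real.sqrt t)) := by field_simp; ring

/-! ## The iteration and the main theorem -/

/-- **The doubling iteration**: if `h_t > 0` on `{1 − Re tr/2 < a}` (`a > 0`) and `3^k a > 1/2`, then `h_{2^{k+2} t} > 0`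
everywhere. [folklore] -/
theorem heatKernelSU2_pos_iterate : ∀ (k : ℕ) {t a : ℝ}, 0 < t → 0 < a →
    (∀ V : Matrix.specialUnitaryGroup (Fin 2) ℂ, 1 - ((V : Matrix (Fin 2) (Fin 2) ℂ)).trace.re / 2 < a →
      0 < ∑' n : ℕ, ((n : ℝ) + 1) * Real.exp (-((n : ℝ) * ((n : ℝ) + 2) / 2) * t) * su2Char n V) →
    1 / 2 < 3 ^ k * a →
    ∀ U : Matrix.specialUnitaryGroup (Fin 2) ℂ,
      0 < ∑' n : ℕ, ((n : ℝ) + 1) * Real.exp (-((n : ℝ) * ((n : ℝ) + 2) / 2) * (2 ^ (k + 2) * t)) * su2Char n U := by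
  -- the common last two steps: from `a > 1/2` at time `t` to everywhere at time `4t`
  have step : ∀ {t a : ℝ}, 0 < t → 1 / 2 < a →
      (∀ V : Matrix.specialUnitaryGroup (Fin 2) ℂ, 1 - ((V : Matrix (Fin 2) (Fin 2) ℂ)).trace.re / 2 < a →
        0 < ∑' n : ℕ, ((n : ℝ) + 1) * Real.exp (-((n : ℝ) * ((n : ℝ) + 2) / 2) * t) * su2Char n V) →
      ∀ U : Matrix.specialUnitaryGroup (Fin 2) ℂ,
        0 < ∑' n : ℕ, ((n : ℝ) + 1) * Real.exp (-((n : ℝ) * ((n : ℝ) + 2) / 2) * ((t + t) + (t + t))) * su2Char n U := by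
    intro t a ht ha hPos U
    rcases lt_or_ge 1 a with ha1 | ha1
    · -- everywhere at `2t`, then propagate to `4t`
      have h2 := heatKernelSU2_pos_everywhere_of_one_lt ht ha1 hPos
      exact heatKernelSU2_pos_mono (by linarith) (by linarith) h2 U
    · have hB : ∀ V : Matrix.specialUnitaryGroup (Fin 2) ℂ, 1 - ((V : Matrix (Fin 2) (Fin 2) ℂ)).trace.re / 2 < 2 * a * (2 - a) →
          0 < ∑' n : ℕ, ((n : ℝ) + 1) * Real.exp (-((n : ℝ) * ((n : ℝ) + 2) / 2) * (t + t)) * su2Char n V :=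
        fun V hV => heatKernelSU2_pos_doubling ht hPos V hV
      have ha' : 1 < 2 * a * (2 - a) := by nlinarith
      exact heatKernelSU2_pos_everywhere_of_one_lt (by linarith) ha' hB U
  intro k
  induction k with
  | zero =>
    intro t a ht ha hPos hk U
    rw [pow_zero, one_mul] at hk
    have h := step ht hk hPos U
    have heq : (2 : ℝ) ^ (0 + 2) * t = (t + t) + (t + t) := by ring
    rw [heq]; exact h
  | succ k ih =>
    intro t a ht ha hPos hk U
    rcases lt_or_ge (1 / 2 : ℝ) a with ha2 | ha2
    · have h := step ht ha2 hPos
      have hle : (t + t) + (t + t) ≤ 2 ^ (k + 1 + 2) * t := by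
        have : (4 : ℝ) ≤ 2 ^ (k + 1 + 2) := by
          rw [pow_succ, pow_succ]
          have : (1 : ℝ) ≤ 2 ^ (k + 1) := one_le_pow₀ (by norm_num)
          nlinarith
        nlinarith
      exact heatKernelSU2_pos_mono (by linarith) hle h U
    · -- double once: the threshold at least triples
      have hB : ∀ V : Matrix.specialUnitaryGroup (Fin 2) ℂ, 1 - ((V : Matrix (Fin 2) (Fin 2) ℂ)).trace.re / 2 < 2 * a * (2 - a) →
          0 < ∑' n : ℕ, ((n : ℝ) + 1) * Real.exp (-((n : ℝ) * ((n : ℝ) + 2) / 2) * (t + t)) * su2Char n V :=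
        fun V hV => heatKernelSU2_pos_doubling ht hPos V hV
      have ha' : 0 < 2 * a * (2 - a) := by nlinarith
      have hk' : 1 / 2 < 3 ^ k * (2 * a * (2 - a)) := by
        have h3 : 3 * a ≤ 2 * a * (2 - a) := by nlinarith
        have h3k : (0 : ℝ) ≤ 3 ^ k := by positivity
        rw [pow_succ] at hk
        nlinarith [mul_le_mul_of_nonneg_left h3 h3k]
      have h := ih (t := t + t) (by linarith) ha' hB hk' U
      have heq : (2 : ℝ) ^ (k + 1 + 2) * t = 2 ^ (k + 2) * (t + t) := by ring
      rw [heq]; exact h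

/-- ★★ **The SU(2) heat kernel is strictly positive**: `h_t(U) = Σ (n+1) e^{-n(n+2)t/2} χ_n(U) > 0` for EVERY `t > 0` and
EVERY `U ∈ SU(2)` (local positivity on a ball of radius `≍ √t`, spreading along square roots through the convolution
semigroup, then propagation in time). [folklore] -/
theorem heatKernelSU2_pos {t : ℝ} (ht : 0 < t) (U : Matrix.specialUnitaryGroup (Fin 2) ℂ) :
    0 < ∑' n : ℕ, ((n : ℝ) + 1) * Real.exp (-((n : ℝ) * ((n : ℝ) + 2) / 2) * t) * su2Char n U := by
  set t' : ℝ := min t 1 with ht'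
  have ht'0 : 0 < t' := lt_min ht one_pos
  have ht'1 : t' ≤ 1 := min_le_right _ _
  have ht't : t' ≤ t := min_le_left _ _
  -- the number of doublings
  obtain ⟨k, hk⟩ := pow_unbounded_of_one_lt (8192 / t') (by norm_num : (1 : ℝ) < 3 / 2)
  set t₁ : ℝ := t' / 2 ^ (k + 2) with ht₁
  have h2k : (0 : ℝ) < 2 ^ (k + 2) := by positivity
  have ht₁0 : 0 < t₁ := div_pos ht'0 h2k
  have ht₁1 : t₁ ≤ 1 := by
    rw [ht₁, div_le_iff₀ h2k]
    have : (1 : ℝ) ≤ 2 ^ (k + 2) := one_le_pow₀ (by norm_num)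
    nlinarith
  have hPos : ∀ V : Matrix.specialUnitaryGroup (Fin 2) ℂ, 1 - ((V : Matrix (Fin 2) (Fin 2) ℂ)).trace.re / 2 < t₁ / 4096 →
      0 < ∑' n : ℕ, ((n : ℝ) + 1) * Real.exp (-((n : ℝ) * ((n : ℝ) + 2) / 2) * t₁) * su2Char n V :=
    fun V hV => heatKernelSU2_pos_of_lt_mul ht₁0 ht₁1 V hV
  have hk' : 1 / 2 < 3 ^ k * (t₁ / 4096) := by
    -- `3^k t₁ / 4096 = (3/2)^k t' / 16384 > (8192/t') t'/16384 = 1/2`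
    have heq : (3 : ℝ) ^ k * (t₁ / 4096) = (3 / 2) ^ k * t' / 16384 := by
      rw [ht₁, div_pow, pow_add]
      field_simp
      ring
    rw [heq]
    have h1 : 8192 / t' * t' < (3 / 2) ^ k * t' := mul_lt_mul_of_pos_right hk ht'0
    rw [div_mul_cancel₀ _ ht'0.ne'] at h1
    linarith
  have hall := heatKernelSU2_pos_iterate k ht₁0 (by positivity) hPos hk'
  have heq : (2 : ℝ) ^ (k + 2) * t₁ = t' := by rw [ht₁]; field_simp
  rw [heq] at hall
  exact heatKernelSU2_pos_mono ht'0 ht't hall U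

/-- ★ **Uniform lower bound**: for every `t > 0` there is `c > 0` with `c ≤ h_t(U)` for all `U ∈ SU(2)` (continuity on the
compact group). [folklore] -/
theorem exists_pos_le_heatKernelSU2 {t : ℝ} (ht : 0 < t) :
    ∃ c : ℝ, 0 < c ∧ ∀ U : Matrix.specialUnitaryGroup (Fin 2) ℂ,
      c ≤ ∑' n : ℕ, ((n : ℝ) + 1) * Real.exp (-((n : ℝ) * ((n : ℝ) + 2) / 2) * t) * su2Char n U := by
  obtain ⟨U₀, -, hmin⟩ := isCompact_univ.exists_isMinOn Set.univ_nonempty (continuous_heatKernelSU2 ht).continuousOn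
  exact ⟨_, heatKernelSU2_pos ht U₀, fun U => hmin (Set.mem_univ U)⟩

/-- The uniform lower bound may be chosen in `(0, 1]` (the form used downstream). [folklore] -/
theorem exists_pos_le_one_le_heatKernelSU2 {t : ℝ} (ht : 0 < t) :
    ∃ c : ℝ, 0 < c ∧ c ≤ 1 ∧ ∀ U : Matrix.specialUnitaryGroup (Fin 2) ℂ,
      c ≤ ∑' n : ℕ, ((n : ℝ) + 1) * Real.exp (-((n : ℝ) * ((n : ℝ) + 2) / 2) * t) * su2Char n U := by
  obtain ⟨c, hc, h⟩ := exists_pos_le_heatKernelSU2 ht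
  exact ⟨min c 1, lt_min hc one_pos, min_le_right _ _, fun U => (min_le_left _ _).trans (h U)⟩

/-- ★ **Product form on `SU(2)^E`**: for `t > 0` there is `c ∈ (0, 1]` with `c^{|E|} ≤ ∏_e h_t(y_e z_e⁻¹)` for all
configurations `z, y`. [folklore] -/
theorem exists_pos_le_prod_heatKernelSU2 {t : ℝ} (ht : 0 < t) (E : Type) [Fintype E] :
    ∃ c : ℝ, 0 < c ∧ c ≤ 1 ∧ ∀ z y : E → Matrix.specialUnitaryGroup (Fin 2) ℂ,
      c ^ Fintype.card E ≤ ∏ e, ∑' n : ℕ, ((n : ℝ) + 1) * Real.exp (-((n : ℝ) * ((n : ℝ) + 2) / 2) * t) *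
        su2Char n (y e * (z e)⁻¹) := by
  classical
  obtain ⟨c, hc, hc1, h⟩ := exists_pos_le_one_le_heatKernelSU2 ht
  refine ⟨c, hc, hc1, fun z y => ?_⟩
  rw [← Finset.card_univ, ← Finset.prod_const]
  exact Finset.prod_le_prod (fun _ _ => hc.le) fun e _ => h _

end Summit.QuantumFields.YangMills.Theorems.ColdStartUniversality

end
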